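import Literature.AlgebraicGeometry.HodgeTheory.NodalPencilSaturatedRadius
import Literature.AlgebraicGeometry.HodgeTheory.CyclicCoverPencilModelIsotopy
import Literature.AlgebraicGeometry.HodgeTheory.CyclicCoverPencilModelIsotopyContinuity
import Literature.AlgebraicGeometry.Motives.UniversalHypersurfaceRegularLocusChartTarget
import Literature.Geometry.ComplexAnalytic.PhamBrieskornWeightedRotation
import HarnessLib

/-!
# The model isotopy of a monomial pencil near a node: coordinates, pencil coordinate, Morse radius, flow law, good set

Family `hodge`, layer `Literature/AlgebraicGeometry/HodgeTheory`. Written by the prover seat `hodge-nonav-prover-Bx` (g15, cell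
`hodge-nonav`) as a brick of the ODP-ISOTOPY port (memo `PROGRAMME-ODP-ISOTOPY-Bx-g13` §2; Picard–Lefschetz binder hPL₁
`picardLefschetz_oneNode` of crux K1-B, stmt-HodgeConjecture-19716): the generalisation of prover-Ax's `CyclicCoverPencilSolvedVector`,
`CyclicCoverPencilModelIsotopyProps`, `…ModelIsotopyRadius`, `…ModelIsotopyFlow` and `…ModelIsotopyGoodSet` (step A3b for the quaternary
cyclic pencil `x₃^p = f₁ + c·x₂^p`, weights `(2, 2, p)`) to an ARBITRARY degree `d ≥ 1`, `n + 2` variables, chart `xᵢ ≠ 0` and the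
monomial pencil direction `xᵢ^d`, at an ORDINARY DOUBLE POINT: all weights are `2`, the model isotopy
`J(θ, x) = chartModelIsotopy (fun _ ↦ 2) Φ Θ θ x = Φ⁻¹(b'(x), Θ⁻¹ R_θ Θ y(x))` (`CyclicCoverPencilModelIsotopy`, generic) rotates every Morse
coordinate by `e^{iθ/2}`, so `J(2π, ·)` is the ANTIPODAL map of the Morse coordinates — the monodromy of the `A₁` model. The pencil is encoded
by the coefficient vector `b₀` of its nodal member (`NodalPencilSaturatedRadius`), the Morse chart by `Σⱼ (Θ y)ⱼ² = φ(y)`,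
`φ(y) = (solved coefficient of xᵢ^d at (b'₀, y)) − (b₀)_{xᵢ^d}`.

For a slice point `x` in the chart with `y(x)` in the chart ball `{Σ|Θ y|² < r²}` (`{Σ|z|² ≤ r²} ⊆ Θ.target`) and pencil coordinate
`0 < |c(x)| < ρW`, assuming the members `b₀ + c'·e_{xᵢ^d}`, `0 < |c'| < ρW`, nonsingular:
* `regChartCoeffVec_slice_eq` — `b(b'₀, y) = b₀ + φ(y)·e_{xᵢ^d}`; `phi_rotated_eq` — `φ(Θ⁻¹ R_θ Θ y(x)) = e^{iθ} c(x)`;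
* `chartModelIsotopy_slice_spec` — `J(θ, x) ∈ Φ.source` with chart coordinates `(b'₀, Θ⁻¹ R_θ Θ y(x))`;
  `chartModelIsotopy_mem_pencilSlice`, `affine_chartModelIsotopy`, `pencilCoord_chartModelIsotopy` (`= e^{iθ} c(x)`),
  `sum_norm_sq_chartModelIsotopy` (same Morse radius), `satRadius_chartModelIsotopy`, `chartModelIsotopy_add` (flow law),
  `mem_goodSet_of_satRadius_lt` (slice points with `F < R₀ ≤ min R''' r²` and `0 < |c| < ρW` lie in the continuity set of
  `CyclicCoverPencilModelIsotopyContinuity.continuousOn_chartModelIsotopy`).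

Everything is proved; no definitions, no named facts. Honest scope: plumbing of the classical construction of the geometric monodromy of a
pencil near an ordinary double point; nothing here says HC or any rung is proved.

## References

* [Milnor1968] J. Milnor, Singular Points of Complex Hypersurfaces (1968), §9 Lemma 9.4 (the model monodromy `z ↦ e^{iθ/aⱼ} z`).
* [ArnoldGuseinzadeVarchenko2012] V. I. Arnold, S. M. Gusein-Zade, A. N. Varchenko, Singularities of Differentiable Maps II (2012),
  Part I §1.1, §2.3.
-/

noncomputable section

open MvPolynomial Set Function Complex
open Literature.AlgebraicGeometry.Motives Literature.AlgebraicGeometry.Motives.UniversalHypersurface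
open Literature.AlgebraicGeometry.HodgeTheory.UniversalHypersurface Literature.Geometry.ComplexAnalytic

namespace Literature.AlgebraicGeometry.HodgeTheory

namespace NodalPencil

/-- **`b(b'₀, y) = b₀ + φ(y)·e_{xᵢ^d}`** for the solved coefficient vector at the remaining coefficients `b'₀` of `b₀`.
[cite: ArnoldGuseinzadeVarchenko2012, Part I §2.3] -/
theorem regChartCoeffVec_slice_eq {n d : ℕ} {i : Fin (n + 2)} (b₀ : DegIndex n d → ℂ) (φ : (Fin (n + 1) → ℂ) → ℂ)
    (hφ : ∀ y, φ y = regChartCoeffVec n d i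
      (Sum.elim (fun m : {m : DegIndex n d // m ≠ regPowIndex n d i} => b₀ m.1) y) (regPowIndex n d i) - b₀ (regPowIndex n d i))
    (y : Fin (n + 1) → ℂ) :
    regChartCoeffVec n d i (Sum.elim (fun m : {m : DegIndex n d // m ≠ regPowIndex n d i} => b₀ m.1) y) =
      b₀ + Pi.single (regPowIndex n d i) (φ y) := by
  funext m
  by_cases hm : m = regPowIndex n d i
  · subst hm
    rw [Pi.add_apply, Pi.single_eq_same, hφ]
    ring
  · rw [regChartCoeffVec_of_ne n d i _ hm, Pi.add_apply, Pi.single_eq_of_ne hm, add_zero]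
    rfl

section Spec

variable {n d : ℕ} {i : Fin (n + 2)} (hd : 0 < d) (b₀ : DegIndex n d → ℂ)
  (Φ : OpenPartialHomeomorph (ComplexPoints (regularTotal ℂ n d)) (({m : DegIndex n d // m ≠ regPowIndex n d i} ⊕ Fin (n + 1)) → ℂ))
  (hΦ : ⇑Φ = regChartFun n d i) (hΦs : Φ.source = regChartDom n d i) (hΦt : Φ.target = regChartFun n d i '' regChartDom n d i)
  (Θ : OpenPartialHomeomorph (Fin (n + 1) → ℂ) (Fin (n + 1) → ℂ)) {r : ℝ}
  (hr : {z : Fin (n + 1) → ℂ | ∑ j, ‖z j‖ ^ 2 ≤ r ^ 2} ⊆ Θ.target)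
  (φ : (Fin (n + 1) → ℂ) → ℂ)
  (hφ : ∀ y, φ y = regChartCoeffVec n d i
    (Sum.elim (fun m : {m : DegIndex n d // m ≠ regPowIndex n d i} => b₀ m.1) y) (regPowIndex n d i) - b₀ (regPowIndex n d i))
  (hΘφ : ∀ y ∈ Θ.source, ∑ j, (Θ y j) ^ 2 = φ y)
  {ρW : ℝ}
  (hns : ∀ c : ℂ, c ≠ 0 → ‖c‖ < ρW →
    SmoothHypersurface.IsNonsingularForm ℂ (formOfCoeffs (b₀ + Pi.single (regPowIndex n d i) c)))
  {x : ComplexPoints (regularTotal ℂ n d)} (hx : x ∈ Φ.source) (hb : x ∈ pencilSlice n d i b₀)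
  (hy : (fun j => regChartFun n d i x (Sum.inr j)) ∈ Θ.source)
  (hyr : ∑ j, ‖Θ (fun j => regChartFun n d i x (Sum.inr j)) j‖ ^ 2 < r ^ 2)
  (hc0 : pencilCoord n d i b₀ x ≠ 0) (hcρ : ‖pencilCoord n d i b₀ x‖ < ρW) (θ : ℝ)
include hd hΦ hΦs hΦt hr hφ hΘφ hns hx hb hy hyr hc0 hcρ

omit hd hΦ hΦt hns hc0 hcρ in
/-- The rotated affine coordinates have pencil value `e^{iθ} c(x)`. [cite: Milnor1968, §9 Lemma 9.4] -/
theorem phi_rotated_eq :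
    φ (Θ.symm (fun k => Complex.exp (((θ / (2 : ℕ) : ℝ) : ℂ) * I) *
        Θ (fun j => regChartFun n d i x (Sum.inr j)) k)) =
      Complex.exp ((θ : ℂ) * I) * pencilCoord n d i b₀ x := by
  have hxd : x ∈ regChartDom n d i := hΦs ▸ hx
  have h1 := PhamBrieskorn.apply_modelIsotopy_eq_exp_mul (fun _ : Fin (n + 1) => 2) Θ (fun _ => two_ne_zero) hr
    (φ := φ) (fun y hy => hΘφ y hy) hy hyr θ
  beta_reduce at h1
  rw [pencilCoord_eq_phi n d i b₀ φ hφ hxd hb]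
  exact h1

/-- **`J(θ, x)` lies in the chart domain with chart coordinates `(b'₀, Θ⁻¹ R_θ Θ y(x))`.** [cite: Milnor1968, §9 Lemma 9.4] -/
theorem chartModelIsotopy_slice_spec :
    chartModelIsotopy (fun _ : Fin (n + 1) => 2) Φ Θ θ x ∈ Φ.source ∧
      Φ (chartModelIsotopy (fun _ : Fin (n + 1) => 2) Φ Θ θ x) =
        Sum.elim (fun m => Φ x (Sum.inl m))
          (Θ.symm (fun k => Complex.exp (((θ / (2 : ℕ) : ℝ) : ℂ) * I) *
            Θ (fun j => Φ x (Sum.inr j)) k)) := by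
  have h := chartModelIsotopy_mem_and_apply (fun _ : Fin (n + 1) => 2) Φ Θ hd hΦt hx (θ := θ) ?_
  · beta_reduce at h
    exact h
  -- the solved form at the rotated coordinates is the pencil member over `e^{iθ} c`
  have hb' : (fun m : {m : DegIndex n d // m ≠ regPowIndex n d i} => Φ x (Sum.inl m)) =
      fun m => b₀ m.1 := by
    funext m; rw [hΦ]; exact hb m
  rw [hb', hΦ, regChartCoeffVec_slice_eq b₀ φ hφ, phi_rotated_eq b₀ Φ hΦs Θ hr φ hφ hΘφ hx hb hy hyr θ]
  refine hns _ (mul_ne_zero (Complex.exp_ne_zero _) hc0) ?_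
  rw [norm_mul, Complex.norm_exp_ofReal_mul_I, one_mul]; exact hcρ

/-- **`J(θ, x)` stays in the pencil slice.** [cite: Milnor1968, §9 Lemma 9.4] -/
theorem chartModelIsotopy_mem_pencilSlice :
    chartModelIsotopy (fun _ : Fin (n + 1) => 2) Φ Θ θ x ∈ pencilSlice n d i b₀ := fun m => by
  obtain ⟨-, hJ⟩ := chartModelIsotopy_slice_spec hd b₀ Φ hΦ hΦs hΦt Θ hr φ hφ hΘφ hns hx hb hy hyr hc0 hcρ θ
  have h := congrFun hJ (Sum.inl m)
  rw [hΦ] at h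
  change regCoeff ℂ n d _ m.1 = regCoeff ℂ n d x m.1 at h
  rw [h]; exact hb m

/-- **The affine coordinates of `J(θ, x)` are the rotated ones.** [cite: Milnor1968, §9 Lemma 9.4] -/
theorem affine_chartModelIsotopy :
    (fun j => regChartFun n d i (chartModelIsotopy (fun _ : Fin (n + 1) => 2) Φ Θ θ x) (Sum.inr j)) =
      Θ.symm (fun k => Complex.exp (((θ / (2 : ℕ) : ℝ) : ℂ) * I) *
        Θ (fun j => regChartFun n d i x (Sum.inr j)) k) := by
  obtain ⟨-, hJ⟩ := chartModelIsotopy_slice_spec hd b₀ Φ hΦ hΦs hΦt Θ hr φ hφ hΘφ hns hx hb hy hyr hc0 hcρ θ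
  funext j
  have h := congrFun hJ (Sum.inr j)
  rw [hΦ] at h
  exact h

/-- **The pencil coordinate of `J(θ, x)` is `e^{iθ} c(x)`.** [cite: Milnor1968, §9 Lemma 9.4] -/
theorem pencilCoord_chartModelIsotopy :
    pencilCoord n d i b₀ (chartModelIsotopy (fun _ : Fin (n + 1) => 2) Φ Θ θ x) =
      Complex.exp ((θ : ℂ) * I) * pencilCoord n d i b₀ x := by
  obtain ⟨hJs, -⟩ := chartModelIsotopy_slice_spec hd b₀ Φ hΦ hΦs hΦt Θ hr φ hφ hΘφ hns hx hb hy hyr hc0 hcρ θ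
  have hJd : chartModelIsotopy (fun _ : Fin (n + 1) => 2) Φ Θ θ x ∈ regChartDom n d i := hΦs ▸ hJs
  rw [pencilCoord_eq_phi n d i b₀ φ hφ hJd
    (chartModelIsotopy_mem_pencilSlice hd b₀ Φ hΦ hΦs hΦt Θ hr φ hφ hΘφ hns hx hb hy hyr hc0 hcρ θ),
    affine_chartModelIsotopy hd b₀ Φ hΦ hΦs hΦt Θ hr φ hφ hΘφ hns hx hb hy hyr hc0 hcρ θ]
  exact phi_rotated_eq b₀ Φ hΦs Θ hr φ hφ hΘφ hx hb hy hyr θ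

/-- **The Morse radius of `J(θ, x)` equals that of `x`** (and its affine coordinates lie in `Θ.source`). [cite: Milnor1968, §9 Lemma 9.4] -/
theorem sum_norm_sq_chartModelIsotopy :
    (fun j => regChartFun n d i (chartModelIsotopy (fun _ : Fin (n + 1) => 2) Φ Θ θ x) (Sum.inr j)) ∈ Θ.source ∧
      ∑ k, ‖Θ (fun j => regChartFun n d i (chartModelIsotopy (fun _ : Fin (n + 1) => 2) Φ Θ θ x) (Sum.inr j)) k‖ ^ 2 =
        ∑ k, ‖Θ (fun j => regChartFun n d i x (Sum.inr j)) k‖ ^ 2 := by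
  obtain ⟨hmem, happ, -⟩ := PhamBrieskorn.modelIsotopy_mem (fun _ : Fin (n + 1) => 2) Θ hr hyr θ
  rw [affine_chartModelIsotopy hd b₀ Φ hΦ hΦs hΦt Θ hr φ hφ hΘφ hns hx hb hy hyr hc0 hcρ θ]
  refine ⟨hmem, ?_⟩
  rw [happ]
  simp_rw [norm_mul, Complex.norm_exp_ofReal_mul_I, one_mul]

/-- **The model isotopy preserves the saturated Morse radius** (`R''' < R''`, `Σ|Θ y(x)|² ≤ R'''`).
[cite: ArnoldGuseinzadeVarchenko2012, Part I §1.1] [cite: Milnor1968, §9 Lemma 9.4] -/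
theorem satRadius_chartModelIsotopy {R''' R'' : ℝ} (hR : R''' < R'')
    (hyR : ∑ k, ‖Θ (fun j => regChartFun n d i x (Sum.inr j)) k‖ ^ 2 ≤ R''') :
    satRadius n d i Θ R''' R'' (chartModelIsotopy (fun _ : Fin (n + 1) => 2) Φ Θ θ x) = satRadius n d i Θ R''' R'' x := by
  obtain ⟨hJs, -⟩ := chartModelIsotopy_slice_spec hd b₀ Φ hΦ hΦs hΦt Θ hr φ hφ hΘφ hns hx hb hy hyr hc0 hcρ θ
  obtain ⟨hyJ, hSigJ⟩ := sum_norm_sq_chartModelIsotopy hd b₀ Φ hΦ hΦs hΦt Θ hr φ hφ hΘφ hns hx hb hy hyr hc0 hcρ θ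
  have hJd : chartModelIsotopy (fun _ : Fin (n + 1) => 2) Φ Θ θ x ∈ regChartDom n d i := hΦs ▸ hJs
  have hxd : x ∈ regChartDom n d i := hΦs ▸ hx
  rw [satRadius_eq_of_le n d i Θ R''' R'' hR hJd hyJ (hSigJ ▸ hyR), satRadius_eq_of_le n d i Θ R''' R'' hR hxd hy hyR, hSigJ]

/-- **Flow law of the model isotopy** at the good points. [cite: Milnor1968, §9 Lemma 9.4] -/
theorem chartModelIsotopy_add (θ' : ℝ) :
    chartModelIsotopy (fun _ : Fin (n + 1) => 2) Φ Θ (θ' + θ) x =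
      chartModelIsotopy (fun _ : Fin (n + 1) => 2) Φ Θ θ'
        (chartModelIsotopy (fun _ : Fin (n + 1) => 2) Φ Θ θ x) := by
  set x' := chartModelIsotopy (fun _ : Fin (n + 1) => 2) Φ Θ θ x with hx'def
  obtain ⟨hx's, hΦx'⟩ := chartModelIsotopy_slice_spec hd b₀ Φ hΦ hΦs hΦt Θ hr φ hφ hΘφ hns hx hb hy hyr hc0 hcρ θ
  have hA := affine_chartModelIsotopy hd b₀ Φ hΦ hΦs hΦt Θ hr φ hφ hΘφ hns hx hb hy hyr hc0 hcρ θ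
  have hB : (fun m : {m : DegIndex n d // m ≠ regPowIndex n d i} => Φ x' (Sum.inl m)) = fun m => Φ x (Sum.inl m) := by
    funext m; exact congrFun hΦx' (Sum.inl m)
  rw [chartModelIsotopy_of_mem _ Φ Θ hx, chartModelIsotopy_of_mem _ Φ Θ hx's, hB]
  congr 1
  funext s
  rcases s with m | j
  · rfl
  · simp only [Sum.elim_inr]
    have hA' : (fun j => Φ x' (Sum.inr j)) =
        Θ.symm (fun k => Complex.exp (((θ / (2 : ℕ) : ℝ) : ℂ) * I) *
          Θ (fun j => regChartFun n d i x (Sum.inr j)) k) := by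
      rw [hΦ]; exact hA
    rw [hA', hΦ]
    have hadd := congrFun (PhamBrieskorn.modelIsotopy_add (fun _ : Fin (n + 1) => 2) Θ hr hyr θ' θ) j
    beta_reduce at hadd
    exact hadd

end Spec

/-- **Good points lie in the continuity set of the model isotopy**: a slice point with `F(x) < R₀ ≤ min R''' r²` (`R''' < R''`) and
`0 < |c(x)| < ρW` belongs to the set on which `continuousOn_chartModelIsotopy` gives joint continuity. [cite: Milnor1968, §9 Lemma 9.4] -/
theorem mem_goodSet_of_satRadius_lt {n d : ℕ} {i : Fin (n + 2)} (hd : 0 < d) (b₀ : DegIndex n d → ℂ)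
    (Φ : OpenPartialHomeomorph (ComplexPoints (regularTotal ℂ n d)) (({m : DegIndex n d // m ≠ regPowIndex n d i} ⊕ Fin (n + 1)) → ℂ))
    (hΦ : ⇑Φ = regChartFun n d i) (hΦs : Φ.source = regChartDom n d i) (hΦt : Φ.target = regChartFun n d i '' regChartDom n d i)
    (Θ : OpenPartialHomeomorph (Fin (n + 1) → ℂ) (Fin (n + 1) → ℂ)) {r R₀ R''' R'' : ℝ}
    (hr : {z : Fin (n + 1) → ℂ | ∑ j, ‖z j‖ ^ 2 ≤ r ^ 2} ⊆ Θ.target)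
    (φ : (Fin (n + 1) → ℂ) → ℂ)
    (hφ : ∀ y, φ y = regChartCoeffVec n d i
      (Sum.elim (fun m : {m : DegIndex n d // m ≠ regPowIndex n d i} => b₀ m.1) y) (regPowIndex n d i) - b₀ (regPowIndex n d i))
    (hΘφ : ∀ y ∈ Θ.source, ∑ j, (Θ y j) ^ 2 = φ y)
    {ρW : ℝ}
    (hns : ∀ c : ℂ, c ≠ 0 → ‖c‖ < ρW →
      SmoothHypersurface.IsNonsingularForm ℂ (formOfCoeffs (b₀ + Pi.single (regPowIndex n d i) c)))
    (hR : R''' < R'') (hR₀ : R₀ ≤ R''') (hR₀r : R₀ ≤ r ^ 2)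
    {x : ComplexPoints (regularTotal ℂ n d)} (hb : x ∈ pencilSlice n d i b₀)
    (hF : satRadius n d i Θ R''' R'' x < R₀) (hc0 : pencilCoord n d i b₀ x ≠ 0) (hcρ : ‖pencilCoord n d i b₀ x‖ < ρW) :
    x ∈ Φ.source ∧ (fun j => Φ x (Sum.inr j)) ∈ Θ.source ∧ ∑ k, ‖Θ (fun j => Φ x (Sum.inr j)) k‖ ^ 2 < r ^ 2 ∧
      ∀ θ : ℝ, (Sum.elim (fun m => Φ x (Sum.inl m))
        (Θ.symm (fun k => Complex.exp (((θ / (2 : ℕ) : ℝ) : ℂ) * I) *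
          Θ (fun j => Φ x (Sum.inr j)) k)) :
            ({m : DegIndex n d // m ≠ regPowIndex n d i} ⊕ Fin (n + 1)) → ℂ) ∈ Φ.target := by
  obtain ⟨hxd, hy, hSig⟩ := mem_of_satRadius_lt n d i Θ R''' R'' hR (lt_of_lt_of_le hF hR₀)
  have hx : x ∈ Φ.source := hΦs ▸ hxd
  have hyr : ∑ k, ‖Θ (fun j => regChartFun n d i x (Sum.inr j)) k‖ ^ 2 < r ^ 2 := by
    rw [hSig]; exact lt_of_lt_of_le hF hR₀r
  refine ⟨hx, by rw [hΦ]; exact hy, by rw [hΦ]; exact hyr, fun θ => ?_⟩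
  obtain ⟨hJs, hJ⟩ := chartModelIsotopy_slice_spec hd b₀ Φ hΦ hΦs hΦt Θ hr φ hφ hΘφ hns hx hb hy hyr hc0 hcρ θ
  rw [← hJ]
  exact Φ.map_source hJs

end NodalPencil

end Literature.AlgebraicGeometry.HodgeTheory

end
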